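import Summits.QuantumFields.YangMills.Theorems.SourcedPressureJensenSourcedPressureIncrementCovarianceFormBound
import Summits.QuantumFields.YangMills.Theorems.SourcedPressureJensenSourcedPressureIncrementGaussSqExpMoment
import Summits.QuantumFields.YangMills.Theorems.SourcedPressureJensenSourcedPressureIncrementGaussIncrementJensen
import HarnessLib

/-!
# `SourcedPressureIncrement` (stmt-QuantumFields-22517), uniform stability (3/3): volume-UNIFORM exponential moments of
# the quadratic plaquette energy and a volume-uniform `h₀` for the Gaussian sourced increment

With `γ = curvatureGaussianField 4 D` (the `ℤ⁴` lattice-Maxwell curvature field with `D` colours), `p₁₂(x)` the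
`(1,2)`-plaquette at `x`, `A_x = (λ/2)|Y(p₁₂ x)|² − m`, `m = (λ/2)·D·C(0)`, `H_B = Σ_{x∈B} A_x A_{x+ne₀}` (the integrand of the
ideator's `gaussIncrement`, skeleton `bc/SourcedPressureIncrement_birth.lean`):

* `integral_exp_mul_sum_sq_gaussianFieldOfKernel_le` — for the Gaussian field of ANY positive semidefinite kernel `K` and any
  finite index set `I` on which the Gram form is bounded by `Λ`: `E exp(t Σ_{s∈I} ω_s²) ≤ exp(2t Σ_{s∈I} K(s,s))` for
  `0 ≤ t`, `4tΛ ≤ 1` (marginal = `N(0, covGram K I)` + the dimension-free bound of file (2/3));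
* `integral_exp_mul_sum_sq_curvature_parallel_le` — for the curvature kernel on any finite set `I` of `(plaquette, colour)`
  indices of ONE orientation: `E exp(t Σ_{s∈I} ω_s²) ≤ exp(2t·|I|·(2/d))` for `0 ≤ t ≤ 1/4`, **uniformly in `I`**
  (the Gram form is `≤ 1` by file (1/3), `K(s,s) = 2/d`);
* `gauss_increment_jensen_uniform` — hence, in `d = 4`, for EVERY `n` and EVERY finite `B ⊂ ℤ⁴` and all
  `0 ≤ h ≤ 1/(λ²D + 4)`: `exp(−hH_B) ∈ L¹(γ)` and `−h·|B|·(λ²D/2)·C(n)² ≤ log E_γ exp(−hH_B)` — the Jensen floor of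
  `gauss_increment_jensen` (w2, `h₀ = h₀(D,λ,n,B)` via Fernique) with an EXPLICIT `h₀ = 1/(λ²D+4)` independent of the
  separation and of the box: item (1) "uniform stability" of the `stub_gauss` anatomy (evidence note on 22517);
* `gauss_increment_le_uniform` — and the a-priori CEILING `log E_γ exp(−hH_B) ≤ h·(λ²D²/2)·|B|` on the same range: the
  Gaussian sourced pressure increment is `O(h)` per site uniformly in `(n, B)` (what any expansion in `h` must refine to
  `−hσC(n)² + O(h²)`).

Everything is proved; no definition, no named fact.  RECORD-label rung support (route `SourcedPressureJensen` → `XiPow`, an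
upper bound on the lattice gap); the Yang–Mills mass gap is NOT proved by anything here. [folklore]
-/

noncomputable section

open MeasureTheory ProbabilityTheory Real Matrix Finset
open Literature.Probability.LatticeModels Literature.MathematicalPhysics.QuantumLattice
open Literature.MathematicalPhysics.QuantumFieldTheory

namespace Summit.QuantumFields.YangMills.Cruxes.SourcedPressureIncrement.Birth

/-! ### Gaussian fields of a kernel: exponential moments of finite sums of squares -/

section Kernel

variable {ι : Type} [DecidableEq ι] {K : ι → ι → ℝ}

omit [DecidableEq ι] in
/-- The Gram quadratic form written as a double sum. [folklore] -/
theorem dotProduct_covGram_mulVec (I : Finset ι) (v : I → ℝ) :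
    v ⬝ᵥ covGram K I *ᵥ v = ∑ s : I, ∑ t : I, v s * v t * K s t := by
  simp only [dotProduct, mulVec, covGram_apply, Finset.mul_sum]
  refine Finset.sum_congr rfl fun s _ => Finset.sum_congr rfl fun t _ => ?_
  ring

omit [DecidableEq ι] in
/-- The trace of the Gram matrix is the sum of the diagonal kernel values. [folklore] -/
theorem trace_covGram (I : Finset ι) : (covGram K I).trace = ∑ s : I, K s s := by
  simp [Matrix.trace, covGram_apply]

/-- **Exponential moments of finite sums of squares under the Gaussian field of a kernel.**  If `K` is positive
semidefinite and on the finite index set `I` its Gram form is bounded by `Λ` (`Σ v_s v_t K(s,t) ≤ Λ Σ v_s²`), then for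
`0 ≤ t` with `4tΛ ≤ 1` the function `exp(t Σ_{s∈I} ω_s²)` is integrable for `gaussianFieldOfKernel K` and
`∫ exp(t Σ_{s∈I} ω_s²) ≤ exp(2t Σ_{s∈I} K(s,s))`. [folklore] -/
theorem integral_exp_mul_sum_sq_gaussianFieldOfKernel_le (hK : IsPosSemidefKernel K) (I : Finset ι) {Λ t : ℝ}
    (ht : 0 ≤ t) (hΛ : ∀ v : I → ℝ, ∑ s : I, ∑ t : I, v s * v t * K s t ≤ Λ * ∑ s : I, v s ^ 2)
    (htΛ : 4 * t * Λ ≤ 1) :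
    Integrable (fun ω : ι → ℝ => Real.exp (t * ∑ s ∈ I, ω s ^ 2)) (gaussianFieldOfKernel K) ∧
      ∫ ω, Real.exp (t * ∑ s ∈ I, ω s ^ 2) ∂gaussianFieldOfKernel K ≤ Real.exp (2 * t * ∑ s : I, K s s) := by
  -- the bound on `EuclideanSpace ℝ I`
  have hΛ' : ∀ v : I → ℝ, v ⬝ᵥ covGram K I *ᵥ v ≤ Λ * (v ⬝ᵥ v) := by
    intro v
    rw [dotProduct_covGram_mulVec]
    have : v ⬝ᵥ v = ∑ s : I, v s ^ 2 := by simp [dotProduct, sq]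
    rw [this]
    exact hΛ v
  obtain ⟨hintE, hleE⟩ := integral_exp_mul_sum_sq_multivariateGaussian_le (hK I) ht hΛ' htΛ
  rw [trace_covGram] at hleE
  -- the function on `I → ℝ` and on `ι → ℝ`
  set g : (I → ℝ) → ℝ := fun x => Real.exp (t * ∑ s : I, x s ^ 2) with hg
  have hgc : Continuous g := by simp only [hg]; fun_prop
  have hcomp : (fun ω : ι → ℝ => Real.exp (t * ∑ s ∈ I, ω s ^ 2)) = g ∘ I.restrict := by
    funext ω
    simp only [hg, Function.comp_apply, Finset.restrict_def]
    rw [← Finset.sum_coe_sort I (fun s => ω s ^ 2)]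
  -- on the marginal
  have hintI : Integrable g (gaussianFamilyOfKernel K I) := by
    rw [gaussianFamilyOfKernel]
    exact (integrable_map_equiv _ g).2 hintE
  have hintegral : ∫ x, g x ∂gaussianFamilyOfKernel K I ≤ Real.exp (2 * t * ∑ s : I, K s s) := by
    rw [integral_gaussianFamilyOfKernel]
    exact hleE
  have himap := integral_map (μ := gaussianFieldOfKernel K) (Finset.measurable_restrict I).aemeasurable
    (f := g) hgc.aestronglyMeasurable
  rw [gaussianFieldOfKernel_map_restrict hK I] at himap
  rw [hcomp]
  constructor
  · rw [← gaussianFieldOfKernel_map_restrict hK I] at hintI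
    exact (integrable_map_measure hgc.aestronglyMeasurable (Finset.measurable_restrict I).aemeasurable).1 hintI
  · show ∫ ω, g (I.restrict ω) ∂gaussianFieldOfKernel K ≤ _
    rw [← himap]
    exact hintegral

end Kernel

/-! ### The curvature field on parallel plaquettes: uniform exponential moments -/

section Curvature

variable {d : ℕ}

/-- **Uniform exponential moments of the quadratic plaquette energy.**  For the curvature kernel (`d ≥ 3`, `D` colours),
every finite set `I` of `(plaquette, colour)` indices of one orientation and `0 ≤ t ≤ 1/4`: `exp(t Σ_{s∈I} ω_s²)` is
integrable for `gaussianFieldOfKernel (curvatureCovKernel d D)` and `∫ exp(t Σ_{s∈I} ω_s²) ≤ exp(2t · |I| · (2/d))` —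
the constant `1/4` and the rate are INDEPENDENT of `I` (Gram form `≤ 1`: `sum_sum_curvatureCovKernel_parallel_le_sum_sq`;
`K(s,s) = 2/d`: `curvatureTwoPoint_self`). [folklore] -/
theorem integral_exp_mul_sum_sq_curvature_parallel_le (hd : 3 ≤ d) (D : ℕ) (ij : {p : Fin d × Fin d // p.1 < p.2})
    (I : Finset (ZdPlaquette d × Fin D)) (hI : ∀ s ∈ I, s.1.2 = ij) {t : ℝ} (ht : 0 ≤ t) (ht4 : t ≤ 1 / 4) :
    Integrable (fun ω : ZdPlaquette d × Fin D → ℝ => Real.exp (t * ∑ s ∈ I, ω s ^ 2))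
        (gaussianFieldOfKernel (curvatureCovKernel d D)) ∧
      ∫ ω, Real.exp (t * ∑ s ∈ I, ω s ^ 2) ∂gaussianFieldOfKernel (curvatureCovKernel d D) ≤
        Real.exp (2 * t * (I.card * (2 / d))) := by
  have hK := isPosSemidefKernel_curvatureCovKernel hd D
  have hΛ : ∀ v : I → ℝ, ∑ s : I, ∑ t : I, v s * v t * curvatureCovKernel d D s t ≤ 1 * ∑ s : I, v s ^ 2 := by
    intro v; rw [one_mul]; exact sum_sum_curvatureCovKernel_parallel_le_sum_sq hd D ij I hI v
  obtain ⟨hint, hle⟩ := integral_exp_mul_sum_sq_gaussianFieldOfKernel_le hK I ht hΛ (by linarith)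
  refine ⟨hint, hle.trans (le_of_eq ?_)⟩
  congr 1
  have hdiag : ∀ s : I, curvatureCovKernel d D s s = 2 / d := fun s => by
    rw [show ((s : ZdPlaquette d × Fin D)) = ((s : ZdPlaquette d × Fin D).1, (s : ZdPlaquette d × Fin D).2) from rfl,
      curvatureCovKernel_apply, if_pos rfl, curvatureTwoPoint_self hd]
  simp only [hdiag, Finset.sum_const, Finset.card_univ, Fintype.card_coe, nsmul_eq_mul]

end Curvature

/-! ### `d = 4`: a volume-uniform `h₀` for the Gaussian sourced increment -/

section Uniform

/-- The index set touched by the source over `B` consists of `(1,2)`-plaquettes only. [folklore] -/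
theorem snd_fst_eq_of_mem_indices (D : ℕ) (n : ℕ) (B : Finset (Site 4)) (s : ZdPlaquette 4 × Fin D)
    (hs : s ∈ (B.image (plaquette12 (d := 4) (by norm_num)) ∪
            B.image (fun x => plaquette12 (d := 4) (by norm_num) (x + Pi.single (0 : Fin 4) (n : ℤ)))) ×ˢ
          (Finset.univ : Finset (Fin D))) :
    s.1.2 = (plaquette12 (d := 4) (by norm_num) (0 : Site 4)).2 := by
  rw [Finset.mem_product] at hs
  rcases Finset.mem_union.1 hs.1 with h | h
  · obtain ⟨x, _, hx⟩ := Finset.mem_image.1 h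
    rw [← hx]; rfl
  · obtain ⟨x, _, hx⟩ := Finset.mem_image.1 h
    rw [← hx]; rfl

/-- Cardinality of the touched index set: at most `2|B|·D`. [folklore] -/
theorem card_indices_le (D : ℕ) (n : ℕ) (B : Finset (Site 4)) :
    (((B.image (plaquette12 (d := 4) (by norm_num)) ∪
            B.image (fun x => plaquette12 (d := 4) (by norm_num) (x + Pi.single (0 : Fin 4) (n : ℤ)))) ×ˢ
          (Finset.univ : Finset (Fin D))).card : ℝ) ≤ 2 * B.card * D := by
  have h1 := Finset.card_image_le (s := B) (f := plaquette12 (d := 4) (by norm_num))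
  have h2 := Finset.card_image_le (s := B)
    (f := fun x => plaquette12 (d := 4) (by norm_num) (x + Pi.single (0 : Fin 4) (n : ℤ)))
  have hU := Finset.card_union_le (B.image (plaquette12 (d := 4) (by norm_num)))
    (B.image (fun x => plaquette12 (d := 4) (by norm_num) (x + Pi.single (0 : Fin 4) (n : ℤ))))
  have hnat : ((B.image (plaquette12 (d := 4) (by norm_num)) ∪
            B.image (fun x => plaquette12 (d := 4) (by norm_num) (x + Pi.single (0 : Fin 4) (n : ℤ)))) ×ˢ
          (Finset.univ : Finset (Fin D))).card ≤ 2 * B.card * D := by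
    rw [Finset.card_product, Finset.card_univ, Fintype.card_fin]
    exact Nat.mul_le_mul_right D (by omega)
  exact_mod_cast hnat

/-- **Volume-uniform integrability and Jensen floor for the Gaussian sourced increment (`d = 4`).**  For every colour number
`D`, scale `λ ≥ 0`, separation `n`, finite `B ⊂ ℤ⁴` and `0 ≤ h ≤ 1/(λ²D + 4)` — an `h₀` INDEPENDENT of `n` and `B` — the
Boltzmann factor `exp(−h Σ_{x∈B} A_x A_{x+ne₀})` is `γ`-integrable and
`−h · |B| · (λ²D/2) · C(n)² ≤ log E_γ exp(−h Σ_{x∈B} A_x A_{x+ne₀})` (integrand of `gaussIncrement` verbatim; compare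
`gauss_increment_jensen`, whose `h₀` depends on `(n, B)`).  Mechanism: `−hH_B ≤ h·m·λ·Σ_{s∈I(B)} ω_s²` and the UNIFORM
exponential moment of file (3/3) at `t = hmλ ≤ 1/4`. [folklore] -/
theorem gauss_increment_jensen_uniform (D : ℕ) {lam : ℝ} (hlam : 0 ≤ lam) (n : ℕ) (B : Finset (Site 4))
    {h : ℝ} (hh : 0 ≤ h) (hhle : h ≤ 1 / (lam ^ 2 * D + 4)) :
    Integrable (fun Y : ZdPlaquette 4 → Fin D → ℝ => Real.exp (-h * ∑ x ∈ B,
        (lam / 2 * (∑ a : Fin D, (Y (plaquette12 (d := 4) (by norm_num) x) a) ^ 2) -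
            lam / 2 * D * curvaturePlaquetteCorr (d := 4) (by norm_num) 0) *
          (lam / 2 * (∑ a : Fin D, (Y (plaquette12 (d := 4) (by norm_num) (x + Pi.single (0 : Fin 4) (n : ℤ))) a) ^ 2) -
            lam / 2 * D * curvaturePlaquetteCorr (d := 4) (by norm_num) 0)))
      (curvatureGaussianField (d := 4) D) ∧
    -h * ((B.card : ℝ) * (lam ^ 2 * D / 2 * (curvaturePlaquetteCorr (d := 4) (by norm_num) (n : ℤ)) ^ 2)) ≤
      Real.log (∫ Y, Real.exp (-h * ∑ x ∈ B,
        (lam / 2 * (∑ a : Fin D, (Y (plaquette12 (d := 4) (by norm_num) x) a) ^ 2) -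
            lam / 2 * D * curvaturePlaquetteCorr (d := 4) (by norm_num) 0) *
          (lam / 2 * (∑ a : Fin D, (Y (plaquette12 (d := 4) (by norm_num) (x + Pi.single (0 : Fin 4) (n : ℤ))) a) ^ 2) -
            lam / 2 * D * curvaturePlaquetteCorr (d := 4) (by norm_num) 0))
        ∂curvatureGaussianField (d := 4) D) ∧
    Real.log (∫ Y, Real.exp (-h * ∑ x ∈ B,
        (lam / 2 * (∑ a : Fin D, (Y (plaquette12 (d := 4) (by norm_num) x) a) ^ 2) -
            lam / 2 * D * curvaturePlaquetteCorr (d := 4) (by norm_num) 0) *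
          (lam / 2 * (∑ a : Fin D, (Y (plaquette12 (d := 4) (by norm_num) (x + Pi.single (0 : Fin 4) (n : ℤ))) a) ^ 2) -
            lam / 2 * D * curvaturePlaquetteCorr (d := 4) (by norm_num) 0))
        ∂curvatureGaussianField (d := 4) D) ≤ h * (lam ^ 2 * D ^ 2 / 2) * B.card := by
  have hd : 3 ≤ 4 := by norm_num
  have hK := isPosSemidefKernel_curvatureCovKernel hd D
  haveI := isProbabilityMeasure_curvatureGaussianField hd D
  haveI := isProbabilityMeasure_gaussianFieldOfKernel hK
  -- abbreviations
  set p : Site 4 → ZdPlaquette 4 := plaquette12 (d := 4) hd with hp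
  set q : Site 4 → ZdPlaquette 4 := fun x => plaquette12 (d := 4) hd (x + Pi.single (0 : Fin 4) (n : ℤ)) with hq
  set m : ℝ := lam / 2 * D * curvaturePlaquetteCorr (d := 4) hd 0 with hm
  have hC0 : curvaturePlaquetteCorr (d := 4) hd 0 = 1 / 2 := by
    rw [curvaturePlaquetteCorr_zero hd]; norm_num
  have hm' : m = lam * D / 4 := by rw [hm, hC0]; ring
  have hm0 : 0 ≤ m := by rw [hm']; positivity
  -- the touched indices and their UNIFORM exponential moment at `t = h m λ ≤ 1/4`
  set I : Finset (ZdPlaquette 4 × Fin D) := (B.image p ∪ B.image q) ×ˢ (Finset.univ : Finset (Fin D)) with hI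
  set c : ℝ := h * (m * lam) with hc
  have hc0 : 0 ≤ c := by positivity
  have hc4 : c ≤ 1 / 4 := by
    rw [hc, hm']
    have h1 : h * (lam ^ 2 * D) ≤ 1 := by
      have hden : 0 < lam ^ 2 * D + 4 := by positivity
      calc h * (lam ^ 2 * D) ≤ 1 / (lam ^ 2 * D + 4) * (lam ^ 2 * D) :=
            mul_le_mul_of_nonneg_right hhle (by positivity)
        _ ≤ 1 := by rw [div_mul_eq_mul_div, div_le_one hden]; linarith
    nlinarith [h1]
  have hIor : ∀ s ∈ I, s.1.2 = (plaquette12 (d := 4) hd (0 : Site 4)).2 := fun s hs =>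
    snd_fst_eq_of_mem_indices D n B s (by simpa [hI, hp, hq] using hs)
  obtain ⟨hintc, hlec⟩ := integral_exp_mul_sum_sq_curvature_parallel_le hd D _ I hIor hc0 hc4
  -- the source on the uncurried configuration space and its domination
  set Hω : (ZdPlaquette 4 × Fin D → ℝ) → ℝ := fun ω => ∑ x ∈ B,
      (lam / 2 * (∑ a : Fin D, ω (p x, a) ^ 2) - m) * (lam / 2 * (∑ a : Fin D, ω (q x, a) ^ 2) - m) with hHω
  have hdom : ∀ ω, -h * Hω ω ≤ c * ∑ s ∈ I, ω s ^ 2 := by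
    intro ω
    have hstep : -Hω ω ≤ m * (lam / 2) * ∑ x ∈ B, ((∑ a : Fin D, ω (p x, a) ^ 2) + ∑ a : Fin D, ω (q x, a) ^ 2) := by
      rw [hHω, ← Finset.sum_neg_distrib, Finset.mul_sum]
      refine Finset.sum_le_sum fun x _ => ?_
      have hS : 0 ≤ lam / 2 * ∑ a : Fin D, ω (p x, a) ^ 2 :=
        mul_nonneg (by positivity) (Finset.sum_nonneg fun a _ => sq_nonneg _)
      have hS' : 0 ≤ lam / 2 * ∑ a : Fin D, ω (q x, a) ^ 2 :=
        mul_nonneg (by positivity) (Finset.sum_nonneg fun a _ => sq_nonneg _)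
      have := neg_centred_mul_centred_le m hS hS'
      nlinarith [this]
    have hidx := sum_colourSq_le_sum_indices D n B ω
    have hnn : 0 ≤ ∑ s ∈ I, ω s ^ 2 := Finset.sum_nonneg fun s _ => sq_nonneg _
    have hsum_le : ∑ x ∈ B, ((∑ a : Fin D, ω (p x, a) ^ 2) + ∑ a : Fin D, ω (q x, a) ^ 2) ≤ 2 * ∑ s ∈ I, ω s ^ 2 := by
      simpa [hp, hq, hI] using hidx
    calc -h * Hω ω = h * (-Hω ω) := by ring
      _ ≤ h * (m * (lam / 2) * (2 * ∑ s ∈ I, ω s ^ 2)) := by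
          refine mul_le_mul_of_nonneg_left (hstep.trans ?_) hh
          exact mul_le_mul_of_nonneg_left hsum_le (by positivity)
      _ = c * ∑ s ∈ I, ω s ^ 2 := by rw [hc]; ring
  -- integrability and the ceiling on the uncurried side
  have hmeasH : Measurable Hω := by
    refine Continuous.measurable ?_
    rw [hHω]
    fun_prop
  have hmeas_exp : AEStronglyMeasurable (fun ω => Real.exp (-h * Hω ω)) (gaussianFieldOfKernel (curvatureCovKernel 4 D)) :=
    (Real.continuous_exp.measurable.comp (hmeasH.const_mul (-h))).aestronglyMeasurable
  have hptw : ∀ ω, ‖Real.exp (-h * Hω ω)‖ ≤ Real.exp (c * ∑ s ∈ I, ω s ^ 2) := fun ω => by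
    rw [Real.norm_eq_abs, abs_of_pos (Real.exp_pos _)]
    exact Real.exp_le_exp.2 (hdom ω)
  have hintω : Integrable (fun ω => Real.exp (-h * Hω ω)) (gaussianFieldOfKernel (curvatureCovKernel 4 D)) :=
    hintc.mono' hmeas_exp (ae_of_all _ hptw)
  have hceilω : ∫ ω, Real.exp (-h * Hω ω) ∂gaussianFieldOfKernel (curvatureCovKernel 4 D) ≤
      Real.exp (h * (lam ^ 2 * D ^ 2 / 2) * B.card) := by
    calc ∫ ω, Real.exp (-h * Hω ω) ∂gaussianFieldOfKernel (curvatureCovKernel 4 D)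
        ≤ ∫ ω, Real.exp (c * ∑ s ∈ I, ω s ^ 2) ∂gaussianFieldOfKernel (curvatureCovKernel 4 D) :=
          integral_mono hintω hintc fun ω => le_trans (le_abs_self _) (by simpa [Real.norm_eq_abs] using hptw ω)
      _ ≤ Real.exp (2 * c * (I.card * (2 / (4 : ℕ)))) := hlec
      _ ≤ Real.exp (h * (lam ^ 2 * D ^ 2 / 2) * B.card) := by
          refine Real.exp_le_exp.2 ?_
          have hcard : (I.card : ℝ) ≤ 2 * B.card * D := by
            have := card_indices_le D n B
            simpa [hI, hp, hq] using this
          have : 2 * c * (I.card * (2 / (4 : ℕ))) = c * I.card := by push_cast; ring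
          rw [this, hc, hm']
          calc h * (lam * D / 4 * lam) * I.card ≤ h * (lam * D / 4 * lam) * (2 * B.card * D) :=
                mul_le_mul_of_nonneg_left hcard (by positivity)
            _ = h * (lam ^ 2 * D ^ 2 / 2) * B.card := by ring
  -- transport to the curvature field (currying)
  have hcomp : ((fun Y : ZdPlaquette 4 → Fin D → ℝ => Real.exp (-h * ∑ x ∈ B,
          (lam / 2 * (∑ a : Fin D, (Y (p x)) a ^ 2) - m) * (lam / 2 * (∑ a : Fin D, (Y (q x)) a ^ 2) - m))) ∘
        ⇑(MeasurableEquiv.curry (ZdPlaquette 4) (Fin D) ℝ)) = fun ω => Real.exp (-h * Hω ω) := by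
    funext ω
    simp only [Function.comp_apply, MeasurableEquiv.coe_curry, Function.curry_apply, hHω]
  have hintY : Integrable (fun Y : ZdPlaquette 4 → Fin D → ℝ => Real.exp (-h * ∑ x ∈ B,
      (lam / 2 * (∑ a : Fin D, (Y (p x)) a ^ 2) - m) * (lam / 2 * (∑ a : Fin D, (Y (q x)) a ^ 2) - m)))
      (curvatureGaussianField (d := 4) D) := by
    rw [curvatureGaussianField]
    refine (integrable_map_equiv _ _).2 ?_
    rw [hcomp]
    exact hintω
  have hintegralY : ∫ Y, Real.exp (-h * ∑ x ∈ B,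
      (lam / 2 * (∑ a : Fin D, (Y (p x)) a ^ 2) - m) * (lam / 2 * (∑ a : Fin D, (Y (q x)) a ^ 2) - m))
      ∂curvatureGaussianField (d := 4) D = ∫ ω, Real.exp (-h * Hω ω) ∂gaussianFieldOfKernel (curvatureCovKernel 4 D) := by
    rw [curvatureGaussianField, integral_map_equiv]
    exact integral_congr_ae (ae_of_all _ fun ω => congrFun hcomp ω)
  refine ⟨hintY, ?_, ?_⟩
  · -- Jensen: exp (∫ −hH) ≤ ∫ exp(−hH)
    have hlin : Integrable (fun Y : ZdPlaquette 4 → Fin D → ℝ => -h * ∑ x ∈ B,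
        (lam / 2 * (∑ a : Fin D, (Y (p x)) a ^ 2) - m) * (lam / 2 * (∑ a : Fin D, (Y (q x)) a ^ 2) - m))
        (curvatureGaussianField (d := 4) D) :=
      (integrable_finsetSum B fun x _ => integrable_gauss_summand D lam n x).const_mul (-h)
    have hJ := ConvexOn.map_integral_le (μ := curvatureGaussianField (d := 4) D) convexOn_exp
      Real.continuous_exp.continuousOn isClosed_univ (ae_of_all _ fun Y => Set.mem_univ _) hlin hintY
    have hfirst : ∫ Y, -h * ∑ x ∈ B,
        (lam / 2 * (∑ a : Fin D, (Y (p x)) a ^ 2) - m) * (lam / 2 * (∑ a : Fin D, (Y (q x)) a ^ 2) - m)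
        ∂curvatureGaussianField (d := 4) D =
        -h * ((B.card : ℝ) * (lam ^ 2 * D / 2 * (curvaturePlaquetteCorr (d := 4) hd (n : ℤ)) ^ 2)) := by
      rw [integral_const_mul, gauss_firstCumulant_sum D lam n B]
    rw [hfirst] at hJ
    have hlog := Real.log_le_log (Real.exp_pos _) hJ
    rwa [Real.log_exp] at hlog
  · -- the ceiling
    rw [hintegralY]
    have hpos : 0 < ∫ ω, Real.exp (-h * Hω ω) ∂gaussianFieldOfKernel (curvatureCovKernel 4 D) :=
      integral_exp_pos hintω
    calc Real.log (∫ ω, Real.exp (-h * Hω ω) ∂gaussianFieldOfKernel (curvatureCovKernel 4 D))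
        ≤ Real.log (Real.exp (h * (lam ^ 2 * D ^ 2 / 2) * B.card)) := Real.log_le_log hpos hceilω
      _ = h * (lam ^ 2 * D ^ 2 / 2) * B.card := Real.log_exp _

end Uniform

end Summit.QuantumFields.YangMills.Cruxes.SourcedPressureIncrement.Birth

end
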